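import Mathlib.Probability.Martingale.Convergence
import Literature.Probability.LatticeModels.ReflectionPositivityExtension
import Literature.Analysis.FunctionSpaces.WeakCompactnessL1Proofs
import HarnessLib

/-!
# Reflection positivity: from bounded local observables to all bounded measurable observables (countable index sets, arbitrary spins)

Theorem-only file (no definitions, no named facts).  The companion file `ReflectionPositivityExtension.lean` proves the
closure property «local ⇒ bounded measurable» of reflection positivity (`IsReflectionPositiveReal`, `IsReflectionPositive`
of `ReflectionPositivity.lean`; Fröhlich–Israel–Lieb–Simon 1978 §2, Biskup 2009 Def. 5.2) for Ising configurations
`{±1}^{ℤ^d}`, where a local observable is automatically bounded.  Here the same closure property is proved for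
configurations `V → S` over ANY countable index set `V` with values in ANY measurable space `S` (real-valued fields
`S = ℝ`, vector spins, …), with the local hypothesis restricted — as it must be for non-compact `S` — to BOUNDED local
observables:

* `isReflectionPositiveReal_of_local_bdd` — if `μ` is a probability measure on `V → S` invariant under the configuration
  reflection `θ*` of a bijection `θ : V ≃ V`, and `0 ≤ ∫ (G ∘ θ*) G dμ` for every bounded real observable `G` measurable
  with respect to the coordinates in a finite set `W ⊆ P` (`MeasureTheory.cylinderEvents ↑W`), then
  `0 ≤ ∫ (F ∘ θ*) F dμ` for every bounded real `F` measurable with respect to the coordinates in `P`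
  (`IsReflectionPositiveReal μ θ P`);
* `isReflectionPositive_of_local_bdd` — hence the complex form `IsReflectionPositive μ θ P`
  (`IsReflectionPositiveReal.isReflectionPositive`).

Proof (Biskup 2009 §5.1; FILS 1978 §2, «weak limits of RP states are RP»): enumerate `V` (an injection `V ↪ ℕ`), let
`W_n = {v ∈ P : #v < n}` and `𝓕_n = σ(coordinates in W_n)`; Lévy's upward theorem (Mathlib `Integrable.tendsto_ae_condExp`)
gives `G_n = μ[F | 𝓕_n] → F` a.e., and `|G_n| ≤ ‖F‖_∞` a.e. (`ae_bdd_abs_condExp_of_ae_bdd_abs`); the TRUNCATIONS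
`G'_n = (G_n ∧ C) ∨ (−C)` are bounded `𝓕_n`-measurable local observables equal to `G_n` a.e., so the hypothesis applies to
them, `θ*`-invariance transports the a.e. statements to `G'_n ∘ θ*`, and dominated convergence passes
`0 ≤ ∫ (G'_n ∘ θ*) G'_n dμ` to the limit.

## References

* M. Biskup, *Reflection positivity and phase transitions in lattice spin models*, LNM 1970 (2009), §5.1, Def. 5.2 and
  remarks. [Biskup2009]
* J. Fröhlich, R. Israel, E. H. Lieb, B. Simon, Comm. Math. Phys. 62 (1978) 1–34, §2. [FILS1978]
* J. Glimm, A. Jaffe, *Quantum Physics* (2nd ed. 1987), §6.1 (the exponential∕local algebra generating `𝓔₊`). [GlimmJaffe1987]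

Mathlib: `MeasureTheory.Filtration`, `Integrable.tendsto_ae_condExp`, `ae_bdd_abs_condExp_of_ae_bdd_abs`,
`stronglyMeasurable_condExp`, `Countable.exists_injective_nat`, `Finset.preimage`, `tendsto_integral_of_dominated_convergence`.
Tree: the truncation letters `abs_max_neg_min_le`, `max_neg_min_eq_self` of `Literature.Analysis.FunctionSpaces` (Dunford–Pettis file).
-/

noncomputable section

open MeasureTheory Filter
open scoped Topology

namespace Literature.Probability.LatticeModels

section LocalToGlobal

variable {V S : Type*} [MeasurableSpace S]

open Literature.Analysis.FunctionSpaces (abs_max_neg_min_le max_neg_min_eq_self)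

/-- **Reflection positivity passes from bounded local observables to all bounded measurable ones** (countable index set,
arbitrary single-spin space).  Let `μ` be a probability measure on `V → S` (`V` countable), invariant under the
configuration reflection `θ*` of a bijection `θ` of `V`, and suppose `0 ≤ ∫ (G ∘ θ*) · G dμ` for every BOUNDED real
observable `G` measurable with respect to the coordinates in a finite set `W ⊆ P`.  Then `0 ≤ ∫ (F ∘ θ*) · F dμ` for every
bounded real `F` measurable with respect to the coordinates in `P`: `IsReflectionPositiveReal μ θ P`.  (Lévy's upward
theorem along `σ(coordinates in W_n)`, `W_n ↑ P` finite, truncation of the conditional expectations at `‖F‖_∞`, dominated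
convergence.) [cite: Biskup2009, §5.1 Def. 5.2] [cite: FILS1978, §2] -/
theorem isReflectionPositiveReal_of_local_bdd [Countable V] {μ : Measure (V → S)} [IsProbabilityMeasure μ]
    {θ : V ≃ V} (hinv : IsReflectionInvariant μ θ) {P : Set V}
    (hloc : ∀ W : Finset V, (↑W : Set V) ⊆ P → ∀ G : (V → S) → ℝ,
      Measurable[cylinderEvents (X := fun _ : V => S) ↑W] G → (∃ C, ∀ σ, |G σ| ≤ C) →
        0 ≤ ∫ σ, G (configReflect θ σ) * G σ ∂μ) :
    IsReflectionPositiveReal μ θ P := by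
  classical
  intro F hF hFb
  obtain ⟨C', hC'⟩ := hFb
  -- a nonnegative bound
  set C : ℝ := max C' 0 with hCdef
  have hC0 : 0 ≤ C := le_max_right _ _
  have hC : ∀ σ, |F σ| ≤ C := fun σ => by
    have := hC' σ
    rw [Real.norm_eq_abs] at this
    exact this.trans (le_max_left _ _)
  -- enumerate `V` and define the finite windows `W n = {v ∈ P | #v < n}`
  obtain ⟨num, hnum⟩ := Countable.exists_injective_nat V
  let W : ℕ → Finset V := fun n => ((Finset.range n).preimage num (hnum.injOn)).filter fun v => v ∈ P
  have hWP : ∀ n, (↑(W n) : Set V) ⊆ P := fun n x hx => by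
    simp only [W, Finset.coe_filter, Set.mem_setOf_eq] at hx
    exact hx.2
  have hWmono : ∀ m n, m ≤ n → (↑(W m) : Set V) ⊆ ↑(W n) := fun m n hmn x hx => by
    simp only [W, Finset.coe_filter, Finset.mem_preimage, Finset.mem_range, Set.mem_setOf_eq] at hx ⊢
    exact ⟨lt_of_lt_of_le hx.1 hmn, hx.2⟩
  let ℱ : Filtration ℕ (MeasurableSpace.pi : MeasurableSpace (V → S)) :=
    { seq := fun n => cylinderEvents (X := fun _ : V => S) ↑(W n)
      mono' := fun m n hmn => cylinderEvents_mono (hWmono m n hmn)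
      le' := fun _ => cylinderEvents_le_pi }
  -- `F` is measurable for `⨆ n, ℱ n ⊇ σ(coordinates in P)`
  have hsup : positiveEvents (S := S) P ≤ ⨆ n, (ℱ n : MeasurableSpace (V → S)) := by
    refine iSup₂_le fun x hx => ?_
    have hxW : x ∈ (↑(W (num x + 1)) : Set V) := by
      simp only [W, Finset.coe_filter, Finset.mem_preimage, Finset.mem_range, Set.mem_setOf_eq]
      exact ⟨Nat.lt_succ_self _, hx⟩
    calc MeasurableSpace.comap (fun σ : V → S => σ x) inferInstance
        ≤ (ℱ (num x + 1) : MeasurableSpace (V → S)) := le_iSup₂_of_le x hxW le_rfl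
      _ ≤ ⨆ n, (ℱ n : MeasurableSpace (V → S)) := le_iSup (fun n => (ℱ n : MeasurableSpace (V → S))) (num x + 1)
  have hFpi : Measurable F := hF.mono cylinderEvents_le_pi le_rfl
  have hFm' : StronglyMeasurable[⨆ n, (ℱ n : MeasurableSpace (V → S))] F := (hF.mono hsup le_rfl).stronglyMeasurable
  have hFint : Integrable F μ := Integrable.of_bound hFpi.aestronglyMeasurable C (ae_of_all _ fun σ => (Real.norm_eq_abs _).le.trans (hC σ))
  -- the conditional expectations and their truncations
  set G : ℕ → (V → S) → ℝ := fun n => μ[F | ℱ n] with hGdef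
  have hGm : ∀ n, Measurable[ℱ n] (G n) := fun n => (stronglyMeasurable_condExp (m := ℱ n) (μ := μ) (f := F)).measurable
  set G' : ℕ → (V → S) → ℝ := fun n σ => max (-C) (min C (G n σ)) with hG'def
  have hG'm : ∀ n, Measurable[ℱ n] (G' n) := fun n =>
    (@measurable_const _ _ _ (ℱ n) (-C)).max ((@measurable_const _ _ _ (ℱ n) C).min (hGm n))
  have hG'mpi : ∀ n, Measurable (G' n) := fun n => (hG'm n).mono (ℱ.le n) le_rfl
  have hG'bdd : ∀ n σ, |G' n σ| ≤ C := fun n σ => abs_max_neg_min_le hC0 _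
  have hGpos : ∀ n, 0 ≤ ∫ σ, G' n (configReflect θ σ) * G' n σ ∂μ := fun n =>
    hloc (W n) (hWP n) (G' n) (hG'm n) ⟨C, hG'bdd n⟩
  -- a.e. convergence `G' n → F`, transported along `θ*` by invariance
  have hqmp : Measure.QuasiMeasurePreserving (configReflect θ) μ μ := ⟨measurable_configReflect θ, by rw [hinv]⟩
  have haeG : ∀ᵐ σ ∂μ, Tendsto (fun n => G n σ) atTop (𝓝 (F σ)) := hFint.tendsto_ae_condExp hFm'
  have hGbdd : ∀ᵐ σ ∂μ, ∀ n, |G n σ| ≤ C := ae_all_iff.2 fun n => ae_bdd_abs_condExp_of_ae_bdd_abs (ae_of_all _ hC)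
  have hae : ∀ᵐ σ ∂μ, Tendsto (fun n => G' n σ) atTop (𝓝 (F σ)) := by
    filter_upwards [haeG, hGbdd] with σ h1 h2
    have heq : (fun n => G' n σ) = fun n => G n σ := funext fun n => max_neg_min_eq_self (h2 n)
    rw [heq]
    exact h1
  have hae' : ∀ᵐ σ ∂μ, Tendsto (fun n => G' n (configReflect θ σ)) atTop (𝓝 (F (configReflect θ σ))) := hqmp.ae hae
  -- dominated convergence
  have hlim : Tendsto (fun n => ∫ σ, G' n (configReflect θ σ) * G' n σ ∂μ) atTop (𝓝 (∫ σ, F (configReflect θ σ) * F σ ∂μ)) := by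
    refine tendsto_integral_of_dominated_convergence (fun _ => C * C) (fun n => ?_) (integrable_const _) (fun n => ae_of_all _ fun σ => ?_) ?_
    · exact (((hG'mpi n).comp (measurable_configReflect θ)).mul (hG'mpi n)).aestronglyMeasurable
    · rw [Real.norm_eq_abs, abs_mul]
      exact mul_le_mul (hG'bdd n _) (hG'bdd n _) (abs_nonneg _) hC0
    · filter_upwards [hae, hae'] with σ h1 h2
      exact h2.mul h1
  exact ge_of_tendsto' hlim hGpos

/-- **Local reflection positivity implies reflection positivity (complex form)** over a countable index set: under the
hypotheses of `isReflectionPositiveReal_of_local_bdd`, `μ` is reflection positive with respect to `θ` and `P` in the sense of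
`IsReflectionPositive` (all bounded complex observables measurable in the coordinates in `P`; FILS 1978 §2, Biskup 2009
Def. 5.2). [cite: Biskup2009, §5.1 Def. 5.2] [cite: FILS1978, §2] -/
theorem isReflectionPositive_of_local_bdd [Countable V] {μ : Measure (V → S)} [IsProbabilityMeasure μ]
    {θ : V ≃ V} (hinv : IsReflectionInvariant μ θ) {P : Set V}
    (hloc : ∀ W : Finset V, (↑W : Set V) ⊆ P → ∀ G : (V → S) → ℝ,
      Measurable[cylinderEvents (X := fun _ : V => S) ↑W] G → (∃ C, ∀ σ, |G σ| ≤ C) →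
        0 ≤ ∫ σ, G (configReflect θ σ) * G σ ∂μ) :
    IsReflectionPositive μ θ P :=
  (isReflectionPositiveReal_of_local_bdd hinv hloc).isReflectionPositive

end LocalToGlobal

end Literature.Probability.LatticeModels
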